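import Summits.BirchSwinnertonDyer.BirchSwinnertonDyer.Theorems.SignedLowerHalvesKobayashiLowerHalfLargeImageKuriharaRigidityThm74Converse
import Summits.BirchSwinnertonDyer.BirchSwinnertonDyer.Theorems.SignedLowerHalvesKobayashiLowerHalfSemistableMuSplit
import Literature.NumberTheory.EllipticCurves.IwasawaSelmerIsTorsionProofs
import Literature.NumberTheory.EllipticCurves.PlusMinusPAdicLFunctionProofs
import Summits.BirchSwinnertonDyer.BirchSwinnertonDyer.Theorems.ResidualThetaTransportAtTwoSignedMuVanishingAtTwoPlusNeronMu
import HarnessLib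

/-!
# Crux `KobayashiLowerHalfSemistable` (route `SignedLowerHalves`, item 2 = stmt-BirchSwinnertonDyer-19000),
# line `birth_musplit`: the SIGN-DEFECT identity — every seam of the typed Eisenstein half
# `KobayashiLowerDivisibility W p ε` is the corresponding seam of Kato's Eisenstein half, sign-free

HONEST FRAMING (cell `bsd-ssimc`, seat `bsd-line-slh-p2` gen 5, de-facto lead of crux 2 on the registered
line `birth_musplit` — `Cruxes/KobayashiLowerHalfSemistable/Lines/birth_musplit.lean`, stubs
`stub_periodFacts · stub_five_le_rational · stub_five_le_mu · stub_three_rational · stub_three_mu`):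
TOOL THEOREMS ONLY — no definition, no named fact minted, no `sorry`, axioms standard; nothing here is a
theorem about a curve; the crux stays OPEN (its engine, Burungale–Skinner–Tian–Wan arXiv:2409.01350
Thm. 1.3, is a preprint); BSD is not proved by any of this. `--supports stmt-BirchSwinnertonDyer-19000`.

WHAT. The sibling seat `bsd-line-slh-p1` put Kobayashi's Thm. 7.4 (Invent. Math. 152 (2003), p. 13:
Kato's main conjecture ⟺ the signed main conjectures, via the three exact sequences
`0 → 𝐇¹(T)^Δ/Z(T)^Δ → Λ/(L_p^ε) → X^ε → X₀ → 0`) in the kernel on the tree's `η = 1` Coleman–Kato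
package (`KuriharaRigidity.fourTerm_data_of_signedColemanKato_of_isTorsion`,
`….charIdeal_mul_eq_of_fourTermExact`, `….kobayashiLowerDivisibility_of_katoEisensteinFrame`). This file
extracts from the same two product identities the single element identity
  `z · g · w = C(u) · L^ε · y`  (`w ∈ Λ^×`, `u ∈ ℤ_p^×` the period ratio)                    (§3)
for ANY generators `z`, `g`, `y` of `char(𝐇¹/Z)`, `char X^ε`, `char X₀`, and reads off it that EVERY
SEAM of the typed Eisenstein half `KobayashiLowerDivisibility W p ε` (the μ-split of
`Theorems/…MuSplit.lean`, which IS the cut of line `birth_musplit`) equals the corresponding seam of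
Kato's Eisenstein half `char X₀ ⊆ char(𝐇¹/Z)` on the package datum (§4, pointwise, torsion of `X^ε`
displayed): the INTEGRAL clause (`lowerClause_iff_charIdeal_le` — `⇒` is the converse the tree did
not have), the RATIONAL clause `L^ε ∣ p^t g ⟺ p^t · char X₀ ⊆ char(𝐇¹/Z)`
(`dvd_C_pow_mul_iff_C_pow_mul_charIdeal_le` = the currency of `stub_*_rational`), and the `μ`-clause
`μ(L^ε) ≤ μ(g) ⟺ μ(z) ≤ μ(y)` (`mu_le_iff_mu_le` = the currency of `stub_*_mu`; the `μ`-DEFECTS of the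
two sides coincide, `mu_add_mu_eq_of_mul_mul_eq`). §1–§2 are the ring lemmas (transfer of a
divisibility along `a · b = c · d` in a domain; `μ` of units). The companion file `…SignDefectX6.lean`
reads these on class X6 with Kobayashi Thm. 1.2, the period facts and the package fact by name, and
shows that on a JOINT package (both signs on one `Z(T)`, as in print) the crux's `∃ ε` is `∀ ε`.

References: [Kobayashi2003] Thm. 1.2, §5 (p. 10), Thm. 6.2/6.3 (p. 11), Thm. 7.3 i) (7.21), Thm. 7.4
and its proof (p. 13); [Kato2004Asterisque] Thm. 12.6 (p. 222), Conj. 12.10 (p. 224);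
[GreenbergVatsal2000] p. 4 (1)–(2), §3 Rem. 3.4; [Washington1997] §7.1, §13.2;
[NeukirchSchmidtWingberg2008] Ch. V §3.
-/

set_option autoImplicit false
-- single-problem summit (D-0017): the doubled namespace component is by design
set_option linter.dupNamespace false

noncomputable section

open scoped Classical MatrixGroups ModularForm

open CongruenceSubgroup Field WeierstrassCurve Literature.NumberTheory.EllipticCurves
  Literature.NumberTheory.EllipticCurves.ModularForms Literature.NumberTheory.GaloisRepresentations
  Literature.NumberTheory.EllipticCurves.Rank1Residual
  Literature.NumberTheory.EllipticCurves.Rank1Residual.Typed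
  Summit.BirchSwinnertonDyer.Rank1Residual.Supersingular
  Summit.BirchSwinnertonDyer.Rank1Residual.X1

namespace Summit.BirchSwinnertonDyer.BirchSwinnertonDyer.Theorems.SignDefect

/-! ## §1 Algebra: one product identity `a · b = c · d` in a domain carries every seam -/

section Algebra

variable {R : Type} [CommRing R] [IsDomain R]

/-- **Transfer along `a · b = c · d`** (any domain): if `c ≠ 0` and `c ∣ s · b` then `a ∣ s · d`
(`c k = s b ⇒ c (a k) = a s b = s (c d) = c (s d)`, cancel `c`). Read with `(a, b, c, d) =
(char 𝐇¹/Z, char X^ε, L_p^ε, char X₀)` along Kobayashi's four-term sequence. [folklore] -/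
theorem dvd_mul_of_mul_eq_mul {a b c d : R} (h : a * b = c * d) (hc : c ≠ 0) {s : R}
    (hcb : c ∣ s * b) : a ∣ s * d := by
  obtain ⟨k, hk⟩ := hcb
  refine ⟨k, mul_left_cancel₀ hc ?_⟩
  calc c * (s * d) = s * (c * d) := by ring
    _ = s * (a * b) := by rw [h]
    _ = a * (s * b) := by ring
    _ = a * (c * k) := by rw [hk]
    _ = c * (a * k) := by ring

/-- The characteristic ideal of any module over a domain is never `⊥`, so a generator of it is
non-zero (`Module.charIdeal_ne_bot`). [folklore] -/
theorem ne_zero_of_charIdeal_eq_span {M : Type} [AddCommGroup M] [Module R M] {x : R}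
    (h : Module.charIdeal R M = Ideal.span {x}) : x ≠ 0 := by
  rintro rfl
  exact Module.charIdeal_ne_bot R M (by rw [h, Ideal.span_singleton_eq_bot])

end Algebra

/-! ## §2 Algebra in `Λ = ℤ_p⟦T⟧`: the `μ`-seam along the identity -/

section Lambda

variable {p : ℕ} [Fact p.Prime]

/-- A unit of `Λ` has `μ = 0`. [cite: Washington1997, §7.1] -/
theorem mu_units (w : (IwasawaAlgebra p)ˣ) : MuLambda.mu (w : IwasawaAlgebra p) = 0 :=
  ((MuLambda.isUnit_iff_mu_eq_zero_and_lam_eq_zero (w : IwasawaAlgebra p)).mp w.isUnit).2.1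

/-! `μ(C(u) · L) = μ(L)` for `u ∈ ℤ_p^×` is the landed `SignedMuAtTwo.mu_C_units_mul` (reused, not restated). -/

/-- **The `μ`-seam along `z · g · w = G · y`** (`w` a unit, all factors non-zero): `μ(z) + μ(g) =
μ(G) + μ(y)`, hence `μ(G) ≤ μ(g) ↔ μ(z) ≤ μ(y)` — the `μ`-defect `μ(G) − μ(g)` of the signed side equals
the `μ`-defect `μ(z) − μ(y)` of the Kato side. [cite: GreenbergVatsal2000, p. 4, (1)–(2)]
[cite: Kobayashi2003, proof of Thm. 7.4 (p. 13)] -/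
theorem mu_add_mu_eq_of_mul_mul_eq {z g G y : IwasawaAlgebra p} (w : (IwasawaAlgebra p)ˣ)
    (h : z * g * (w : IwasawaAlgebra p) = G * y) (hz : z ≠ 0) (hg : g ≠ 0) (hG : G ≠ 0) (hy : y ≠ 0) :
    MuLambda.mu z + MuLambda.mu g = MuLambda.mu G + MuLambda.mu y := by
  have h1 : MuLambda.mu (z * g * (w : IwasawaAlgebra p)) = MuLambda.mu z + MuLambda.mu g := by
    rw [MuLambda.mu_mul (mul_ne_zero hz hg) w.ne_zero, MuLambda.mu_mul hz hg, mu_units, add_zero]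
  have h2 : MuLambda.mu (G * y) = MuLambda.mu G + MuLambda.mu y := MuLambda.mu_mul hG hy
  rw [← h1, ← h2, h]

/-- The `μ`-inequality transfers across the identity: `μ(G) ≤ μ(g) ↔ μ(z) ≤ μ(y)`. [folklore] -/
theorem mu_le_iff_of_mul_mul_eq {z g G y : IwasawaAlgebra p} (w : (IwasawaAlgebra p)ˣ)
    (h : z * g * (w : IwasawaAlgebra p) = G * y) (hz : z ≠ 0) (hg : g ≠ 0) (hG : G ≠ 0) (hy : y ≠ 0) :
    MuLambda.mu G ≤ MuLambda.mu g ↔ MuLambda.mu z ≤ MuLambda.mu y := by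
  have := mu_add_mu_eq_of_mul_mul_eq w h hz hg hG hy
  omega

end Lambda

/-! ## §3 The identity on a sign-`ε` Coleman–Kato package: `(char 𝐇¹/Z)·(char X^ε) = (ϖ L_p^ε)·(char X₀)` -/

section Package

variable (W : WeierstrassCurve ℚ) [W.IsElliptic] [W.IsGloballyMinimal] (p : ℕ) [Fact p.Prime]
  [ContinuousSMul ℤ_[p] (W.tateModule p)] [Module.Free ℤ_[p] (W.tateModule p)]
  [Module.Finite ℤ_[p] (W.tateModule p)]

omit [W.IsGloballyMinimal] in
/-- **The sign-defect identity on one package datum.** `W/ℚ`, `p` odd good with `a_p = 0` and `E[p]`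
irreducible; a frame (`κ, γ` the cyclotomic tower with generator, `f` a newform of `W`, `ϖ` the period
ratio with `ord_p ϖ = 0`, a Pollack pair `(L⁺, L⁻)`), a TORSION dual datum `D` of `Sel^ε(E/ℚ_∞)`, a fine
dual `Y` (`X₀`) and a sign-`ε` Coleman–Kato package datum `d` on a pinned `I = 𝐇¹(T)^Δ` (Kobayashi Thm.
6.2/6.3/7.3 i) + Kato 12.6). For ANY generators `z`, `g`, `y` of `char(I.H ⧸ d.Z)`, `char X^ε`, `char X₀`:
all are non-zero and `z · g · w = C(u) · L^ε · y` for a unit `w ∈ Λ^×` and the `p`-adic unit `u` with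
`u = ϖ` in `ℚ_p` (`L^ε = kobayashiL ε L⁺ L⁻`). Proof: the two product identities
`char(Λ/col Z) = char(𝐇¹/Z)·char Q'`, `char X^ε = char Q'·char X₀` along
`0 → 𝐇¹/Z → Λ/col Z → X^ε → X₀ → 0` (tree `KuriharaRigidity.charIdeal_mul_eq_of_fourTermExact`, data
`KuriharaRigidity.fourTerm_data_of_signedColemanKato_of_isTorsion`) with `char(Λ/col Z) = (G₁)`,
`ι G₁ = ϖ · ι L^ε`, and `G₁ = C(u) · L^ε` by injectivity of `ι`.
[cite: Kobayashi2003, proof of Thm. 7.4 (p. 13), Thm. 7.3 i) (7.21), Thm. 6.3 (p. 11)]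
[cite: NeukirchSchmidtWingberg2008, Ch. V §3] -/
theorem mul_mul_eq_of_signedColemanKato
    (hirr : W.HasIrreducibleModPGaloisRep p) {ε : ℤˣ}
    {κ : ZpExtension ℚ p} {γ : absoluteGaloisGroup ℚ} (hγ : κ.IsTopGenerator γ)
    {N : ℕ} [NeZero N] {f : CuspForm (Gamma0 N) 2} (hf : IsNewformOf W f)
    {ϖ : ℚ} (hϖ : (ϖ : ℝ) * W.realPeriodRat = plusPeriod f) (hvϖ : padicValRat p ϖ = 0)
    {Lplus Lminus : IwasawaAlgebra p} (hL : IsPollackPair f p Lplus Lminus)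
    (D : Kobayashi2003.SignedSelmerDualData W κ γ ε) (hDtor : Module.IsTorsion (IwasawaAlgebra p) D.X)
    {I : Kato2004.IwasawaH1Data W p κ γ}
    (Y : W.FineSelmerDualData κ γ) (d : Kobayashi2003.SignedColemanKatoData W p f ϖ κ γ ε I)
    {z g y : IwasawaAlgebra p}
    (hz : Module.charIdeal (IwasawaAlgebra p) (I.H ⧸ d.Z) = Ideal.span {z})
    (hg : Module.charIdeal (IwasawaAlgebra p) D.X = Ideal.span {g})
    (hy : Module.charIdeal (IwasawaAlgebra p) Y.X = Ideal.span {y}) :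
    z ≠ 0 ∧ g ≠ 0 ∧ y ≠ 0 ∧
    ∃ (u : ℤ_[p]ˣ) (w : (IwasawaAlgebra p)ˣ), ((u : ℤ_[p]) : ℚ_[p]) = ((ϖ : ℚ) : ℚ_[p]) ∧
      z * g * (w : IwasawaAlgebra p) = PowerSeries.C (u : ℤ_[p]) * kobayashiL ε Lplus Lminus * y := by
  haveI : Module.Finite (IwasawaAlgebra p) Y.X :=
    WeierstrassCurve.FineSelmerDualData.module_finite _ κ hγ Y
  have hz0 : z ≠ 0 := ne_zero_of_charIdeal_eq_span hz
  have hg0 : g ≠ 0 := ne_zero_of_charIdeal_eq_span hg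
  have hy0 : y ≠ 0 := ne_zero_of_charIdeal_eq_span hy
  refine ⟨hz0, hg0, hy0, ?_⟩
  obtain ⟨hYtor, G₁, hG₁0, hG₁, hcharJ, hQtor, i, j', k', hi, hij, hjk', hk'⟩ :=
    KuriharaRigidity.fourTerm_data_of_signedColemanKato_of_isTorsion W p hirr hf hϖ hvϖ hL D hDtor Y d
  obtain ⟨e1, e2⟩ :=
    KuriharaRigidity.charIdeal_mul_eq_of_fourTermExact hQtor hYtor i j' k' hi hij hjk' hk'
  -- `char(𝐇¹/Z)` of the SUBMODULE-quotient vs the source of `i`: `i` is injective with range `= ker j'`,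
  -- and `charIdeal_mul_eq_of_fourTermExact` is stated with `A = I.H ⧸ d.Z` itself
  obtain ⟨q, hq⟩ := (charIdeal_isPrincipal_holds p (LinearMap.range j')).principal
  have hq' : Module.charIdeal (IwasawaAlgebra p) (LinearMap.range j') = Ideal.span {q} := hq
  rw [hcharJ, hz, hq', Ideal.span_singleton_mul_span_singleton] at e1
  rw [hg, hq', hy, Ideal.span_singleton_mul_span_singleton] at e2
  -- `G₁ ~ z q`, `g ~ q y`, hence `z g ~ G₁ y`
  have hA1 : Associated G₁ (z * q) := Ideal.span_singleton_eq_span_singleton.mp e1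
  have hA2 : Associated g (q * y) := Ideal.span_singleton_eq_span_singleton.mp e2
  have hA3 : Associated (z * g) (z * q * y) := by
    have h := hA2.mul_left z
    rwa [← mul_assoc] at h
  have hA : Associated (z * g) (G₁ * y) := hA3.trans (hA1.symm.mul_right y)
  obtain ⟨w, hw⟩ := hA
  -- `G₁ = C(u) · L^ε`
  have hϖ0 : ϖ ≠ 0 := hf.periodRatio_ne_zero hϖ
  obtain ⟨u, hu⟩ := exists_units_coe_eq_ratCast hϖ0 hvϖ
  have hG₁eq : G₁ = PowerSeries.C (u : ℤ_[p]) * kobayashiL ε Lplus Lminus :=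
    (MuSplit.iota_eq_C_mul_iota_iff u hu G₁ _).mp hG₁
  exact ⟨u, w, hu, by rw [hw, hG₁eq]⟩

/-! ## §4 The three seams on one package datum: integral (the crux's clause), rational, `μ` -/

omit [W.IsGloballyMinimal] in
/-- **Integral seam, pointwise.** In the frame of `mul_mul_eq_of_signedColemanKato`: the crux's clause for
the datum `D` — `char X^ε = (g)` with `ι g = ϖ · ι(L^ε · h)` for some `h ∈ Λ` — holds IFF Kato's Eisenstein
inclusion `char X₀ ⊆ char(𝐇¹/Z)` holds on the package datum `d` (`⇐` is the tree's
`KuriharaRigidity.kobayashiLowerDivisibility_of_katoEisensteinFrame` read pointwise; `⇒` is new: transfer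
`C(u)L^ε ∣ g` to `z ∣ y` along `z · g · w = C(u) · L^ε · y`). [cite: Kobayashi2003, proof of Thm. 7.4 (p. 13)]
[cite: Kato2004Asterisque, Conj. 12.10 (p. 224)] -/
theorem lowerClause_iff_charIdeal_le
    (hirr : W.HasIrreducibleModPGaloisRep p) {ε : ℤˣ}
    {κ : ZpExtension ℚ p} {γ : absoluteGaloisGroup ℚ} (hγ : κ.IsTopGenerator γ)
    {N : ℕ} [NeZero N] {f : CuspForm (Gamma0 N) 2} (hf : IsNewformOf W f)
    {ϖ : ℚ} (hϖ : (ϖ : ℝ) * W.realPeriodRat = plusPeriod f) (hvϖ : padicValRat p ϖ = 0)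
    {Lplus Lminus : IwasawaAlgebra p} (hL : IsPollackPair f p Lplus Lminus)
    (D : Kobayashi2003.SignedSelmerDualData W κ γ ε) (hDtor : Module.IsTorsion (IwasawaAlgebra p) D.X)
    {I : Kato2004.IwasawaH1Data W p κ γ}
    (Y : W.FineSelmerDualData κ γ) (d : Kobayashi2003.SignedColemanKatoData W p f ϖ κ γ ε I) :
    (∃ g h : IwasawaAlgebra p, D.charIdeal = Ideal.span {g} ∧
        iwasawaToPowerSeries p g =
          PowerSeries.C ((ϖ : ℚ) : ℚ_[p]) * iwasawaToPowerSeries p (kobayashiL ε Lplus Lminus * h)) ↔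
    Module.charIdeal (IwasawaAlgebra p) Y.X ≤ Module.charIdeal (IwasawaAlgebra p) (I.H ⧸ d.Z) := by
  obtain ⟨z, hz⟩ := (charIdeal_isPrincipal_holds p (I.H ⧸ d.Z)).principal
  obtain ⟨y, hy⟩ := (charIdeal_isPrincipal_holds p Y.X).principal
  obtain ⟨g₀, hg₀⟩ := (charIdeal_isPrincipal_holds p D.X).principal
  have hz' : Module.charIdeal (IwasawaAlgebra p) (I.H ⧸ d.Z) = Ideal.span {z} := hz
  have hy' : Module.charIdeal (IwasawaAlgebra p) Y.X = Ideal.span {y} := hy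
  have hg₀' : Module.charIdeal (IwasawaAlgebra p) D.X = Ideal.span {g₀} := hg₀
  obtain ⟨hz0, -, -, u, w, hu, hzgw⟩ :=
    mul_mul_eq_of_signedColemanKato W p hirr hγ hf hϖ hvϖ hL D hDtor Y d hz' hg₀' hy'
  set L : IwasawaAlgebra p := kobayashiL ε Lplus Lminus with hLdef
  have hCu0 : (PowerSeries.C (u : ℤ_[p]) : IwasawaAlgebra p) ≠ 0 := by
    rw [Ne, ← map_zero (PowerSeries.C (R := ℤ_[p])), (PowerSeries.C_injective).eq_iff]
    exact Units.ne_zero u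
  have hL0 : L ≠ 0 := by
    rw [hLdef, kobayashiL]
    split_ifs
    · exact hL.2.1
    · exact hL.1
  have hc0 : PowerSeries.C (u : ℤ_[p]) * L ≠ 0 := mul_ne_zero hCu0 hL0
  have hId : z * (g₀ * (w : IwasawaAlgebra p)) = PowerSeries.C (u : ℤ_[p]) * L * y := by
    rw [← mul_assoc]; exact hzgw
  constructor
  · rintro ⟨g, h, hchar, hι⟩
    have hchar' : Module.charIdeal (IwasawaAlgebra p) D.X = Ideal.span {g} := hchar
    have hgeq : g = PowerSeries.C (u : ℤ_[p]) * (L * h) := (MuSplit.iota_eq_C_mul_iota_iff u hu g _).mp hι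
    obtain ⟨v, hv⟩ := Ideal.span_singleton_eq_span_singleton.mp (hchar'.symm.trans hg₀')
    -- `g * v = g₀`
    have hdvd : PowerSeries.C (u : ℤ_[p]) * L ∣ 1 * (g₀ * (w : IwasawaAlgebra p)) := by
      rw [one_mul, ← hv, hgeq]
      exact ⟨h * (v : IwasawaAlgebra p) * (w : IwasawaAlgebra p), by ring⟩
    have hzy : z ∣ y := by simpa only [one_mul] using dvd_mul_of_mul_eq_mul hId hc0 hdvd
    rw [hy', hz']
    exact Ideal.span_singleton_le_span_singleton.mpr hzy
  · intro hle
    rw [hy', hz', Ideal.span_singleton_le_span_singleton] at hle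
    have h1 : PowerSeries.C (u : ℤ_[p]) * L ∣ 1 * (g₀ * (w : IwasawaAlgebra p)) :=
      dvd_mul_of_mul_eq_mul hId.symm hz0 (by simpa only [one_mul] using hle)
    rw [one_mul] at h1
    obtain ⟨k, hk⟩ := Units.dvd_mul_right.mp h1
    refine ⟨g₀, k, hg₀', (MuSplit.iota_eq_C_mul_iota_iff u hu g₀ _).mpr ?_⟩
    rw [hk, mul_assoc]

omit [W.IsGloballyMinimal] in
/-- **Rational seam, pointwise.** Same frame: `L^ε ∣ p^t · g` for some generator `g` of `char X^ε` and some
`t` (the Eisenstein divisibility in `Λ ⊗ ℚ_p`) IFF `p^t · char X₀ ⊆ char(𝐇¹/Z)` for some `t` (Kato's Eisenstein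
inclusion in `Λ ⊗ ℚ_p`). [cite: Kobayashi2003, proof of Thm. 7.4 (p. 13)] [cite: Kato2004Asterisque, Conj. 12.10 (p. 224)] -/
theorem dvd_C_pow_mul_iff_C_pow_mul_charIdeal_le
    (hirr : W.HasIrreducibleModPGaloisRep p) {ε : ℤˣ}
    {κ : ZpExtension ℚ p} {γ : absoluteGaloisGroup ℚ} (hγ : κ.IsTopGenerator γ)
    {N : ℕ} [NeZero N] {f : CuspForm (Gamma0 N) 2} (hf : IsNewformOf W f)
    {ϖ : ℚ} (hϖ : (ϖ : ℝ) * W.realPeriodRat = plusPeriod f) (hvϖ : padicValRat p ϖ = 0)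
    {Lplus Lminus : IwasawaAlgebra p} (hL : IsPollackPair f p Lplus Lminus)
    (D : Kobayashi2003.SignedSelmerDualData W κ γ ε) (hDtor : Module.IsTorsion (IwasawaAlgebra p) D.X)
    {I : Kato2004.IwasawaH1Data W p κ γ}
    (Y : W.FineSelmerDualData κ γ) (d : Kobayashi2003.SignedColemanKatoData W p f ϖ κ γ ε I) :
    (∃ (g : IwasawaAlgebra p) (t : ℕ), D.charIdeal = Ideal.span {g} ∧
        kobayashiL ε Lplus Lminus ∣ PowerSeries.C (p : ℤ_[p]) ^ t * g) ↔
    ∃ t : ℕ, Ideal.span {PowerSeries.C (p : ℤ_[p]) ^ t} * Module.charIdeal (IwasawaAlgebra p) Y.X ≤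
      Module.charIdeal (IwasawaAlgebra p) (I.H ⧸ d.Z) := by
  obtain ⟨z, hz⟩ := (charIdeal_isPrincipal_holds p (I.H ⧸ d.Z)).principal
  obtain ⟨y, hy⟩ := (charIdeal_isPrincipal_holds p Y.X).principal
  obtain ⟨g₀, hg₀⟩ := (charIdeal_isPrincipal_holds p D.X).principal
  have hz' : Module.charIdeal (IwasawaAlgebra p) (I.H ⧸ d.Z) = Ideal.span {z} := hz
  have hy' : Module.charIdeal (IwasawaAlgebra p) Y.X = Ideal.span {y} := hy
  have hg₀' : Module.charIdeal (IwasawaAlgebra p) D.X = Ideal.span {g₀} := hg₀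
  obtain ⟨hz0, -, -, u, w, -, hzgw⟩ :=
    mul_mul_eq_of_signedColemanKato W p hirr hγ hf hϖ hvϖ hL D hDtor Y d hz' hg₀' hy'
  set L : IwasawaAlgebra p := kobayashiL ε Lplus Lminus with hLdef
  have hCu : IsUnit (PowerSeries.C (u : ℤ_[p]) : IwasawaAlgebra p) :=
    (Units.isUnit u).map (PowerSeries.C (R := ℤ_[p]))
  have hL0 : L ≠ 0 := by
    rw [hLdef, kobayashiL]
    split_ifs
    · exact hL.2.1
    · exact hL.1
  have hc0 : PowerSeries.C (u : ℤ_[p]) * L ≠ 0 := mul_ne_zero hCu.ne_zero hL0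
  have hId : z * (g₀ * (w : IwasawaAlgebra p)) = PowerSeries.C (u : ℤ_[p]) * L * y := by
    rw [← mul_assoc]; exact hzgw
  -- `C(u) L ∣ x ↔ L ∣ x`
  have hCuL : ∀ x : IwasawaAlgebra p, PowerSeries.C (u : ℤ_[p]) * L ∣ x ↔ L ∣ x := fun x ↦ by
    obtain ⟨c, hc⟩ := hCu
    rw [← hc, Units.mul_left_dvd]
  constructor
  · rintro ⟨g, t, hchar, hdvd⟩
    have hchar' : Module.charIdeal (IwasawaAlgebra p) D.X = Ideal.span {g} := hchar
    obtain ⟨v, hv⟩ := Ideal.span_singleton_eq_span_singleton.mp (hchar'.symm.trans hg₀')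
    -- `g * v = g₀`
    have h1 : PowerSeries.C (u : ℤ_[p]) * L ∣
        PowerSeries.C (p : ℤ_[p]) ^ t * (g₀ * (w : IwasawaAlgebra p)) := by
      rw [hCuL, ← hv, show PowerSeries.C (p : ℤ_[p]) ^ t * (g * (v : IwasawaAlgebra p) *
        (w : IwasawaAlgebra p)) = PowerSeries.C (p : ℤ_[p]) ^ t * g * ((v : IwasawaAlgebra p) *
        (w : IwasawaAlgebra p)) by ring]
      exact Dvd.dvd.mul_right hdvd _
    have h2 : z ∣ PowerSeries.C (p : ℤ_[p]) ^ t * y := dvd_mul_of_mul_eq_mul hId hc0 h1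
    refine ⟨t, ?_⟩
    rw [hy', hz', Ideal.span_singleton_mul_span_singleton, Ideal.span_singleton_le_span_singleton]
    exact h2
  · rintro ⟨t, hle⟩
    rw [hy', hz', Ideal.span_singleton_mul_span_singleton, Ideal.span_singleton_le_span_singleton] at hle
    have h1 : PowerSeries.C (u : ℤ_[p]) * L ∣
        PowerSeries.C (p : ℤ_[p]) ^ t * (g₀ * (w : IwasawaAlgebra p)) :=
      dvd_mul_of_mul_eq_mul hId.symm hz0 hle
    rw [hCuL, ← mul_assoc, Units.dvd_mul_right] at h1
    exact ⟨g₀, t, hg₀', h1⟩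

omit [W.IsGloballyMinimal] in
/-- **`μ`-seam, pointwise.** Same frame: `μ(L^ε) ≤ μ(g)` for some generator `g` of `char X^ε` IFF
`μ(z) ≤ μ(y)` for ALL generators `z` of `char(𝐇¹/Z)` and `y` of `char X₀` (the `μ`-defects of the signed and
the Kato side coincide). [cite: Kobayashi2003, proof of Thm. 7.4 (p. 13)] [cite: GreenbergVatsal2000, p. 4, (1)–(2)] -/
theorem mu_le_iff_mu_le
    (hirr : W.HasIrreducibleModPGaloisRep p) {ε : ℤˣ}
    {κ : ZpExtension ℚ p} {γ : absoluteGaloisGroup ℚ} (hγ : κ.IsTopGenerator γ)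
    {N : ℕ} [NeZero N] {f : CuspForm (Gamma0 N) 2} (hf : IsNewformOf W f)
    {ϖ : ℚ} (hϖ : (ϖ : ℝ) * W.realPeriodRat = plusPeriod f) (hvϖ : padicValRat p ϖ = 0)
    {Lplus Lminus : IwasawaAlgebra p} (hL : IsPollackPair f p Lplus Lminus)
    (D : Kobayashi2003.SignedSelmerDualData W κ γ ε) (hDtor : Module.IsTorsion (IwasawaAlgebra p) D.X)
    {I : Kato2004.IwasawaH1Data W p κ γ}
    (Y : W.FineSelmerDualData κ γ) (d : Kobayashi2003.SignedColemanKatoData W p f ϖ κ γ ε I) :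
    (∃ g : IwasawaAlgebra p, D.charIdeal = Ideal.span {g} ∧
        MuLambda.mu (kobayashiL ε Lplus Lminus) ≤ MuLambda.mu g) ↔
    ∀ z y : IwasawaAlgebra p, Module.charIdeal (IwasawaAlgebra p) (I.H ⧸ d.Z) = Ideal.span {z} →
      Module.charIdeal (IwasawaAlgebra p) Y.X = Ideal.span {y} → MuLambda.mu z ≤ MuLambda.mu y := by
  set L : IwasawaAlgebra p := kobayashiL ε Lplus Lminus with hLdef
  have hL0 : L ≠ 0 := by
    rw [hLdef, kobayashiL]
    split_ifs
    · exact hL.2.1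
    · exact hL.1
  constructor
  · rintro ⟨g, hchar, hμ⟩ z y hz hy
    have hchar' : Module.charIdeal (IwasawaAlgebra p) D.X = Ideal.span {g} := hchar
    obtain ⟨hz0, hg0, hy0, u, w, -, hzgw⟩ :=
      mul_mul_eq_of_signedColemanKato W p hirr hγ hf hϖ hvϖ hL D hDtor Y d hz hchar' hy
    have hCu0 : (PowerSeries.C (u : ℤ_[p]) : IwasawaAlgebra p) ≠ 0 := by
      rw [Ne, ← map_zero (PowerSeries.C (R := ℤ_[p])), (PowerSeries.C_injective).eq_iff]
      exact Units.ne_zero u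
    have key := mu_le_iff_of_mul_mul_eq w hzgw hz0 hg0 (mul_ne_zero hCu0 hL0) hy0
    rw [SignedMuAtTwo.mu_C_units_mul u hL0] at key
    exact key.mp hμ
  · intro h
    obtain ⟨z, hz⟩ := (charIdeal_isPrincipal_holds p (I.H ⧸ d.Z)).principal
    obtain ⟨y, hy⟩ := (charIdeal_isPrincipal_holds p Y.X).principal
    obtain ⟨g₀, hg₀⟩ := (charIdeal_isPrincipal_holds p D.X).principal
    have hz' : Module.charIdeal (IwasawaAlgebra p) (I.H ⧸ d.Z) = Ideal.span {z} := hz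
    have hy' : Module.charIdeal (IwasawaAlgebra p) Y.X = Ideal.span {y} := hy
    have hg₀' : Module.charIdeal (IwasawaAlgebra p) D.X = Ideal.span {g₀} := hg₀
    obtain ⟨hz0, hg0, hy0, u, w, -, hzgw⟩ :=
      mul_mul_eq_of_signedColemanKato W p hirr hγ hf hϖ hvϖ hL D hDtor Y d hz' hg₀' hy'
    have hCu0 : (PowerSeries.C (u : ℤ_[p]) : IwasawaAlgebra p) ≠ 0 := by
      rw [Ne, ← map_zero (PowerSeries.C (R := ℤ_[p])), (PowerSeries.C_injective).eq_iff]
      exact Units.ne_zero u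
    have key := mu_le_iff_of_mul_mul_eq w hzgw hz0 hg0 (mul_ne_zero hCu0 hL0) hy0
    rw [SignedMuAtTwo.mu_C_units_mul u hL0] at key
    exact ⟨g₀, hg₀', key.mpr (h z y hz' hy')⟩

omit [W.IsGloballyMinimal] in
/-- **The zeta quotient of a JOINT package is one module.** Two package data on the same pinned `I`
with the same zeta submodule (`d₁.Z = d₂.Z`, as in print: Kato's `Z(T)` is chosen before the sign)
have the same `char(𝐇¹/Z)`. [cite: Kobayashi2003, §5 (p. 10) and proof of Thm. 7.4 (p. 13)] -/
theorem charIdeal_quot_eq_of_Z_eq {κ : ZpExtension ℚ p} {γ : absoluteGaloisGroup ℚ}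
    {N : ℕ} {f : CuspForm (Gamma0 N) 2} {ϖ : ℚ} {ε₁ ε₂ : ℤˣ} {I : Kato2004.IwasawaH1Data W p κ γ}
    (d₁ : Kobayashi2003.SignedColemanKatoData W p f ϖ κ γ ε₁ I)
    (d₂ : Kobayashi2003.SignedColemanKatoData W p f ϖ κ γ ε₂ I) (hZ : d₁.Z = d₂.Z) :
    Module.charIdeal (IwasawaAlgebra p) (I.H ⧸ d₁.Z) =
      Module.charIdeal (IwasawaAlgebra p) (I.H ⧸ d₂.Z) :=
  Module.charIdeal_eq_of_linearEquiv (Submodule.quotEquivOfEq _ _ hZ)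

end Package

end Summit.BirchSwinnertonDyer.BirchSwinnertonDyer.Theorems.SignDefect

end
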